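import Summits.CriticalPhenomena.PercolationContinuityZ3.Theorems.PercNearOneGluingNoHeavyQuantLawDecUsageMongeRates
import Summits.CriticalPhenomena.PercolationContinuityZ3.Theorems.PercNearOneGluingNoHeavyQuantBlobDecTwoLawParts
import HarnessLib

/-!
# QUANT lane R8, T-DEC: the MONGE SWAP preserves the flow form of DEC — the exchange step of the CORNER normal form (LEAD-NOTES-G21 N45 (4))

builds on p205010 (kernel theorem, internal audit signed; external expert review pending)

Support file (`--supports stmt-CriticalPhenomena-4575`), QUANT lane typer seat prim-quant-stmt (gen 23), rung R8 of
`run/shared/lean/prim/quant/LADDER.md`.  One `Prop` definition (`LawDec.IsFlowAtT`, the body of `LawDec.FlowAtT` for a NAMED flow `f`),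
theorems otherwise; standard axioms, no sorries.  First kernel piece of the lead's ask "the Lean CORNER theorem over `FlowAtT`" (README V240/V244,
N45 (4)): of the four exchange cases in the proof that some optimal flow saturates the corner pair `(l*, m*)`, the only one with mathematical
content is the MONGE SWAP; it is proved here for an arbitrary feasible flow.  The induction on `#lows + #mids` and the definition of the corner
run are left to the next file.

* `LawDec.IsFlowAtT x T j′ M μ f` — `f` is a witness of `LawDec.FlowAtT x T j′ M μ` (same four clauses); `flowAtT_iff_exists_isFlowAtT`.
* `LawDec.IsFlowAtT.shift` — moving `ε` of a low's mass from `(l₂,h₂)` to a compatible absorber `(l₂,h₁)` with slack `≥ ε·usage(l₂,h₁)` keeps a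
  witness (first exchange case).
* **`LawDec.IsFlowAtT.uncross`** — lows `l₁ < l₂` (`l₂ ≤ j′`, `2l₂ < T`), absorbers `h₁ < h₂ ≤ M` with `T < l₁ + h₁` (so all four pairs are
  compatible — compatibility is an upper set) and `h₁, h₂` non-low; for `0 ≤ ε ≤ f l₂ h₂` with `ε·usage(l₂,h₁) ≤ usage(l₁,h₁)·f l₁ h₁`, the flow
  `f − ε·e(l₂,h₂) + ε·e(l₂,h₁) − δ·e(l₁,h₁) + δ·e(l₁,h₂)`, `δ = ε·usage(l₂,h₁)/usage(l₁,h₁)`, is again a witness: rows are unchanged, the load of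
  `h₁` is unchanged, and the load of `h₂` does not increase BY THE MONGE INEQUALITY `usage(l₂,h₁)·usage(l₁,h₂) ≤ usage(l₁,h₁)·usage(l₂,h₂)`
  (`LawDec.usage_monge`, lead g21 p291762).  Iterating it moves the mass of the highest low towards its lowest compatible absorber without
  losing feasibility — the corner rule (N45 (2): exact LP optimum in 1 675 179 / 1 675 179 instances).

[this work]; flow normal form `…QuantLawDecFlows` (typer g22), Monge rates `…QuantLawDecUsageMonge(Rates)` (lead g21) (this lane).  Monge arrays /
corner rules for transportation problems are classical (Hoffman 1963; Burkard–Klinz–Rudolf 1996); the gains variant here is an exchange argument,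
nothing is cited as a published result.  The gluing rows served [cite: KozmaNitzan2024, Conjecture 3 (p. 15)]; product measure
[cite: Grimmett1999, §1.3 p. 10].
-/

noncomputable section

namespace Summit.CriticalPhenomena.PercolationContinuityZ3.Theorems

namespace Quant

open Finset

namespace LawDec

/-- **a named witness of the flow form of DEC(j′) at target `T`**: the four clauses of `LawDec.FlowAtT` for the flow `f`. [this work] -/
def IsFlowAtT (x T : ℝ) (j' M : ℕ) (μ : ℕ → ℝ) (f : ℕ → ℕ → ℝ) : Prop :=
  (∀ l h, 0 ≤ f l h) ∧
    (∀ l h, 0 < f l h → l ≤ j' ∧ 2 * (l : ℝ) < T ∧ h ≤ M ∧ (j' + 1 ≤ h ∨ T < (l : ℝ) + h)) ∧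
    (∀ l, l ≤ j' → 2 * (l : ℝ) < T → ∑ h ∈ Finset.range (M + 1), f l h = μ l) ∧
    (∀ h, h ≤ M → (j' + 1 ≤ h ∨ T ≤ 2 * (h : ℝ)) → ∑ l ∈ Finset.range (j' + 1), usage x T j' l h * f l h ≤ μ h)

/-- `FlowAtT` is the existence of a named witness. [this work] -/
theorem flowAtT_iff_exists_isFlowAtT (x T : ℝ) (j' M : ℕ) (μ : ℕ → ℝ) :
    FlowAtT x T j' M μ ↔ ∃ f, IsFlowAtT x T j' M μ f :=
  Iff.rfl

/-- `Σ_{i ∈ s} g i · [i = a] = g a` for `a ∈ s`. -/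
theorem sum_mul_indicator_eq (s : Finset ℕ) (g : ℕ → ℝ) (a : ℕ) (ha : a ∈ s) :
    ∑ i ∈ s, g i * (if i = a then (1:ℝ) else 0) = g a := by
  rw [Finset.sum_eq_single a]
  · rw [if_pos rfl, mul_one]
  · intro i _ hne; rw [if_neg hne, mul_zero]
  · intro hna; exact absurd ha hna

/-- **usage of a compatible absorber is positive** (`2l < T`, `l < h`, and `h` a giant or `T < l + h`; `0 < x < 1`). [this work] -/
theorem usage_pos_of_compat (x T : ℝ) (j' l h : ℕ) (hx0 : 0 < x) (hx1 : x < 1) (hlow : 2 * (l : ℝ) < T) (hlh : l < h)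
    (hc : j' + 1 ≤ h ∨ T < (l : ℝ) + h) : 0 < usage x T j' l h := by
  simp only [usage, gateOf]
  split_ifs with hg
  · exact div_pos hx0 (by linarith)
  · have hc' : T < (l : ℝ) + h := by
      rcases hc with hc | hc
      · exact absurd hc hg
      · exact hc
    have h0 := pairGate_pos x T l h hlow hlh
    have h1 := pairGate_lt_one x T l h hx0 hx1 hlow hc'
    exact div_pos h0 (by linarith)

/-- **THE MONGE SWAP PRESERVES FEASIBILITY.**  See the file header. [this work] -/
theorem IsFlowAtT.uncross {x T : ℝ} {j' M : ℕ} {μ : ℕ → ℝ} {f : ℕ → ℕ → ℝ} (hF : IsFlowAtT x T j' M μ f)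
    (hx0 : 0 < x) (hx1 : x < 1) (l₁ l₂ h₁ h₂ : ℕ) (hl : l₁ < l₂) (hh : h₁ < h₂) (hl2 : l₂ ≤ j') (hlow : 2 * (l₂ : ℝ) < T)
    (hh2M : h₂ ≤ M) (hcomp : T < (l₁ : ℝ) + h₁) (habs₁ : j' + 1 ≤ h₁ ∨ T ≤ 2 * (h₁ : ℝ))
    (ε : ℝ) (hε0 : 0 ≤ ε) (hε : ε ≤ f l₂ h₂) (hδ : ε * usage x T j' l₂ h₁ ≤ usage x T j' l₁ h₁ * f l₁ h₁) :
    IsFlowAtT x T j' M μ (fun l h => f l h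
      + ε * (if l = l₂ then (1:ℝ) else 0) * (if h = h₁ then (1:ℝ) else 0)
      - ε * (if l = l₂ then (1:ℝ) else 0) * (if h = h₂ then (1:ℝ) else 0)
      + (ε * usage x T j' l₂ h₁ / usage x T j' l₁ h₁) * (if l = l₁ then (1:ℝ) else 0) * (if h = h₂ then (1:ℝ) else 0)
      - (ε * usage x T j' l₂ h₁ / usage x T j' l₁ h₁) * (if l = l₁ then (1:ℝ) else 0) * (if h = h₁ then (1:ℝ) else 0)) := by
  classical
  obtain ⟨hf0, hsupp, hrow, hcol⟩ := hF
  have hl' : (l₁ : ℝ) < l₂ := by exact_mod_cast hl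
  have hh' : (h₁ : ℝ) < h₂ := by exact_mod_cast hh
  have hlow1 : 2 * (l₁ : ℝ) < T := by linarith
  have hl1j : l₁ ≤ j' := by omega
  have hh1M : h₁ ≤ M := by omega
  have hne_l : l₁ ≠ l₂ := by omega
  have hne_h : h₁ ≠ h₂ := by omega
  -- compatibility of all four pairs (upper set)
  have hc11 : j' + 1 ≤ h₁ ∨ T < (l₁ : ℝ) + h₁ := Or.inr hcomp
  have hc21 : j' + 1 ≤ h₁ ∨ T < (l₂ : ℝ) + h₁ := Or.inr (by linarith)
  have hc12 : j' + 1 ≤ h₂ ∨ T < (l₁ : ℝ) + h₂ := Or.inr (by linarith)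
  have hlh11 : l₁ < h₁ := by
    by_contra hge
    push Not at hge
    have : (h₁ : ℝ) ≤ l₁ := by exact_mod_cast hge
    linarith
  have hlh21 : l₂ < h₁ := by
    by_contra hge
    push Not at hge
    have : (h₁ : ℝ) ≤ l₂ := by exact_mod_cast hge
    linarith
  have hu11 : 0 < usage x T j' l₁ h₁ := usage_pos_of_compat x T j' l₁ h₁ hx0 hx1 hlow1 hlh11 hc11
  have hu21 : 0 < usage x T j' l₂ h₁ := usage_pos_of_compat x T j' l₂ h₁ hx0 hx1 hlow hlh21 hc21
  set δ : ℝ := ε * usage x T j' l₂ h₁ / usage x T j' l₁ h₁ with hδdef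
  have hδ0 : 0 ≤ δ := div_nonneg (mul_nonneg hε0 hu21.le) hu11.le
  have hδle : δ ≤ f l₁ h₁ := by rw [hδdef, div_le_iff₀ hu11]; linarith
  have hδ1 : δ * usage x T j' l₁ h₁ = ε * usage x T j' l₂ h₁ := by rw [hδdef]; field_simp
  -- Monge: the load of h₂ does not increase
  have hmonge := usage_monge x T j' l₁ l₂ h₁ h₂ hx0 hx1 hl hh hlow hcomp habs₁
  have hδ2 : δ * usage x T j' l₁ h₂ ≤ ε * usage x T j' l₂ h₂ := by
    rw [hδdef, div_mul_eq_mul_div, div_le_iff₀ hu11]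
    nlinarith [mul_le_mul_of_nonneg_left hmonge hε0]
  have ind_nn : ∀ (P : Prop) [Decidable P], (0:ℝ) ≤ (if P then (1:ℝ) else 0) := fun P _ => by split_ifs <;> norm_num
  -- the value of the new flow off / on the four touched entries
  have val_other : ∀ l h, l ≠ l₁ → l ≠ l₂ → f l h
      + ε * (if l = l₂ then (1:ℝ) else 0) * (if h = h₁ then (1:ℝ) else 0)
      - ε * (if l = l₂ then (1:ℝ) else 0) * (if h = h₂ then (1:ℝ) else 0)
      + δ * (if l = l₁ then (1:ℝ) else 0) * (if h = h₂ then (1:ℝ) else 0)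
      - δ * (if l = l₁ then (1:ℝ) else 0) * (if h = h₁ then (1:ℝ) else 0) = f l h := by
    intro l h h1 h2; rw [if_neg h1, if_neg h2]; ring
  have val_l2 : ∀ h, f l₂ h
      + ε * (if l₂ = l₂ then (1:ℝ) else 0) * (if h = h₁ then (1:ℝ) else 0)
      - ε * (if l₂ = l₂ then (1:ℝ) else 0) * (if h = h₂ then (1:ℝ) else 0)
      + δ * (if l₂ = l₁ then (1:ℝ) else 0) * (if h = h₂ then (1:ℝ) else 0)
      - δ * (if l₂ = l₁ then (1:ℝ) else 0) * (if h = h₁ then (1:ℝ) else 0)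
      = f l₂ h + ε * (if h = h₁ then (1:ℝ) else 0) - ε * (if h = h₂ then (1:ℝ) else 0) := by
    intro h; rw [if_pos rfl, if_neg (Ne.symm hne_l)]; ring
  have val_l1 : ∀ h, f l₁ h
      + ε * (if l₁ = l₂ then (1:ℝ) else 0) * (if h = h₁ then (1:ℝ) else 0)
      - ε * (if l₁ = l₂ then (1:ℝ) else 0) * (if h = h₂ then (1:ℝ) else 0)
      + δ * (if l₁ = l₁ then (1:ℝ) else 0) * (if h = h₂ then (1:ℝ) else 0)
      - δ * (if l₁ = l₁ then (1:ℝ) else 0) * (if h = h₁ then (1:ℝ) else 0)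
      = f l₁ h + δ * (if h = h₂ then (1:ℝ) else 0) - δ * (if h = h₁ then (1:ℝ) else 0) := by
    intro h; rw [if_pos rfl, if_neg hne_l]; ring
  refine ⟨?_, ?_, ?_, ?_⟩
  · -- nonnegativity
    intro l h
    dsimp only
    by_cases hl2' : l = l₂
    · rw [hl2', val_l2]
      by_cases hh2' : h = h₂
      · rw [hh2', if_pos rfl, if_neg (Ne.symm hne_h)]; linarith
      · rw [if_neg hh2']; have := hf0 l₂ h; have := ind_nn (h = h₁); nlinarith
    · by_cases hl1' : l = l₁
      · rw [hl1', val_l1]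
        by_cases hh1' : h = h₁
        · rw [hh1', if_pos rfl, if_neg hne_h]; linarith
        · rw [if_neg hh1']; have := hf0 l₁ h; have := ind_nn (h = h₂); nlinarith
      · rw [val_other l h hl1' hl2']; exact hf0 l h
  · -- support
    intro l h hpos
    dsimp only at hpos
    by_cases hl2' : l = l₂
    · rw [hl2', val_l2] at hpos
      rw [hl2']
      by_cases hh1' : h = h₁
      · rw [hh1']; exact ⟨hl2, hlow, hh1M, hc21⟩
      · rw [if_neg hh1'] at hpos
        have : 0 < f l₂ h := by have := ind_nn (h = h₂); nlinarith
        exact hsupp l₂ h this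
    · by_cases hl1' : l = l₁
      · rw [hl1', val_l1] at hpos
        rw [hl1']
        by_cases hh2' : h = h₂
        · rw [hh2']; exact ⟨hl1j, hlow1, hh2M, hc12⟩
        · rw [if_neg hh2'] at hpos
          have : 0 < f l₁ h := by have := ind_nn (h = h₁); nlinarith
          exact hsupp l₁ h this
      · rw [val_other l h hl1' hl2'] at hpos
        exact hsupp l h hpos
  · -- rows are unchanged
    intro l hlj hllow
    dsimp only
    have hr1 := BlobDec2.sum_range_const_indicator M h₁ hh1M (ε * (if l = l₂ then (1:ℝ) else 0))
    have hr2 := BlobDec2.sum_range_const_indicator M h₂ hh2M (ε * (if l = l₂ then (1:ℝ) else 0))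
    have hr3 := BlobDec2.sum_range_const_indicator M h₂ hh2M (δ * (if l = l₁ then (1:ℝ) else 0))
    have hr4 := BlobDec2.sum_range_const_indicator M h₁ hh1M (δ * (if l = l₁ then (1:ℝ) else 0))
    simp only [Finset.sum_add_distrib, Finset.sum_sub_distrib]
    rw [hr1, hr2, hr3, hr4, hrow l hlj hllow]
    ring
  · -- columns: h₁ unchanged, h₂ does not increase, others unchanged
    intro h hhM hself
    dsimp only
    have hl2r : l₂ ∈ Finset.range (j' + 1) := Finset.mem_range.2 (by omega)
    have hl1r : l₁ ∈ Finset.range (j' + 1) := Finset.mem_range.2 (by omega)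
    have e : ∀ l, usage x T j' l h * (f l h
          + ε * (if l = l₂ then (1:ℝ) else 0) * (if h = h₁ then (1:ℝ) else 0)
          - ε * (if l = l₂ then (1:ℝ) else 0) * (if h = h₂ then (1:ℝ) else 0)
          + δ * (if l = l₁ then (1:ℝ) else 0) * (if h = h₂ then (1:ℝ) else 0)
          - δ * (if l = l₁ then (1:ℝ) else 0) * (if h = h₁ then (1:ℝ) else 0))
        = usage x T j' l h * f l h
          + ((ε * (if h = h₁ then (1:ℝ) else 0) * usage x T j' l h) * (if l = l₂ then (1:ℝ) else 0)
          - (ε * (if h = h₂ then (1:ℝ) else 0) * usage x T j' l h) * (if l = l₂ then (1:ℝ) else 0))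
          + ((δ * (if h = h₂ then (1:ℝ) else 0) * usage x T j' l h) * (if l = l₁ then (1:ℝ) else 0)
          - (δ * (if h = h₁ then (1:ℝ) else 0) * usage x T j' l h) * (if l = l₁ then (1:ℝ) else 0)) := fun l => by ring
    have hs1 : ∑ l ∈ Finset.range (j' + 1), (ε * (if h = h₁ then (1:ℝ) else 0) * usage x T j' l h) * (if l = l₂ then (1:ℝ) else 0)
        = ε * (if h = h₁ then (1:ℝ) else 0) * usage x T j' l₂ h :=
      sum_mul_indicator_eq _ (fun l => ε * (if h = h₁ then (1:ℝ) else 0) * usage x T j' l h) l₂ hl2r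
    have hs2 : ∑ l ∈ Finset.range (j' + 1), (ε * (if h = h₂ then (1:ℝ) else 0) * usage x T j' l h) * (if l = l₂ then (1:ℝ) else 0)
        = ε * (if h = h₂ then (1:ℝ) else 0) * usage x T j' l₂ h :=
      sum_mul_indicator_eq _ (fun l => ε * (if h = h₂ then (1:ℝ) else 0) * usage x T j' l h) l₂ hl2r
    have hs3 : ∑ l ∈ Finset.range (j' + 1), (δ * (if h = h₂ then (1:ℝ) else 0) * usage x T j' l h) * (if l = l₁ then (1:ℝ) else 0)
        = δ * (if h = h₂ then (1:ℝ) else 0) * usage x T j' l₁ h :=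
      sum_mul_indicator_eq _ (fun l => δ * (if h = h₂ then (1:ℝ) else 0) * usage x T j' l h) l₁ hl1r
    have hs4 : ∑ l ∈ Finset.range (j' + 1), (δ * (if h = h₁ then (1:ℝ) else 0) * usage x T j' l h) * (if l = l₁ then (1:ℝ) else 0)
        = δ * (if h = h₁ then (1:ℝ) else 0) * usage x T j' l₁ h :=
      sum_mul_indicator_eq _ (fun l => δ * (if h = h₁ then (1:ℝ) else 0) * usage x T j' l h) l₁ hl1r
    simp only [e, Finset.sum_add_distrib, Finset.sum_sub_distrib]
    rw [hs1, hs2, hs3, hs4]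
    have hold := hcol h hhM hself
    by_cases hh1' : h = h₁
    · subst hh1'
      rw [if_pos rfl, if_neg hne_h]
      simp only [mul_one, mul_zero, zero_mul, sub_zero]
      linarith
    · rw [if_neg hh1']
      by_cases hh2' : h = h₂
      · subst hh2'
        rw [if_pos rfl]
        simp only [mul_one, mul_zero, zero_mul, sub_zero]
        linarith
      · rw [if_neg hh2']
        simp only [mul_zero, zero_mul, add_zero, sub_zero]
        exact hold

/-- **SHIFTING WITHIN A ROW TOWARDS AN ABSORBER WITH SLACK PRESERVES FEASIBILITY**: for a low `l₂` and a compatible absorber `h₁ ≤ M` whose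
load has slack `≥ ε·usage(l₂,h₁)`, moving `0 ≤ ε ≤ f l₂ h₂` from `(l₂,h₂)` to `(l₂,h₁)` gives again a witness (the first exchange case of
N45 (4)). [this work] -/
theorem IsFlowAtT.shift {x T : ℝ} {j' M : ℕ} {μ : ℕ → ℝ} {f : ℕ → ℕ → ℝ} (hF : IsFlowAtT x T j' M μ f)
    (hx0 : 0 < x) (hx1 : x < 1) (l₂ h₁ h₂ : ℕ) (hne : h₁ ≠ h₂) (hl2 : l₂ ≤ j') (hlow : 2 * (l₂ : ℝ) < T) (hh1M : h₁ ≤ M)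
    (hc : j' + 1 ≤ h₁ ∨ T < (l₂ : ℝ) + h₁) (ε : ℝ) (hε0 : 0 ≤ ε) (hε : ε ≤ f l₂ h₂)
    (hslack : ∑ l ∈ Finset.range (j' + 1), usage x T j' l h₁ * f l h₁ + ε * usage x T j' l₂ h₁ ≤ μ h₁) :
    IsFlowAtT x T j' M μ (fun l h => f l h
      + ε * (if l = l₂ then (1:ℝ) else 0) * (if h = h₁ then (1:ℝ) else 0)
      - ε * (if l = l₂ then (1:ℝ) else 0) * (if h = h₂ then (1:ℝ) else 0)) := by
  classical
  obtain ⟨hf0, hsupp, hrow, hcol⟩ := hF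
  have ind_nn : ∀ (P : Prop) [Decidable P], (0:ℝ) ≤ (if P then (1:ℝ) else 0) := fun P _ => by split_ifs <;> norm_num
  -- usage of the old pair is nonnegative on what is moved
  have hu22 : 0 ≤ ε * usage x T j' l₂ h₂ := by
    rcases hε0.lt_or_eq with hpos | h0
    · have hf : 0 < f l₂ h₂ := lt_of_lt_of_le hpos hε
      obtain ⟨_, _, _, hc2⟩ := hsupp l₂ h₂ hf
      have hlh : l₂ < h₂ := by
        rcases hc2 with hc2 | hc2
        · omega
        · by_contra hge
          push Not at hge
          have : (h₂ : ℝ) ≤ l₂ := by exact_mod_cast hge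
          linarith
      exact mul_nonneg hε0 (usage_pos_of_compat x T j' l₂ h₂ hx0 hx1 hlow hlh hc2).le
    · rw [← h0, zero_mul]
  have val_other : ∀ l h, l ≠ l₂ → f l h
      + ε * (if l = l₂ then (1:ℝ) else 0) * (if h = h₁ then (1:ℝ) else 0)
      - ε * (if l = l₂ then (1:ℝ) else 0) * (if h = h₂ then (1:ℝ) else 0) = f l h := by
    intro l h h2; rw [if_neg h2]; ring
  have val_l2 : ∀ h, f l₂ h
      + ε * (if l₂ = l₂ then (1:ℝ) else 0) * (if h = h₁ then (1:ℝ) else 0)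
      - ε * (if l₂ = l₂ then (1:ℝ) else 0) * (if h = h₂ then (1:ℝ) else 0)
      = f l₂ h + ε * (if h = h₁ then (1:ℝ) else 0) - ε * (if h = h₂ then (1:ℝ) else 0) := by
    intro h; rw [if_pos rfl]; ring
  refine ⟨?_, ?_, ?_, ?_⟩
  · -- nonnegativity
    intro l h
    dsimp only
    by_cases hl2' : l = l₂
    · rw [hl2', val_l2]
      by_cases hh2' : h = h₂
      · rw [hh2', if_pos rfl, if_neg (Ne.symm hne)]; linarith
      · rw [if_neg hh2']; have := hf0 l₂ h; have := ind_nn (h = h₁); nlinarith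
    · rw [val_other l h hl2']; exact hf0 l h
  · -- support
    intro l h hpos
    dsimp only at hpos
    by_cases hl2' : l = l₂
    · rw [hl2', val_l2] at hpos
      rw [hl2']
      by_cases hh1' : h = h₁
      · rw [hh1']; exact ⟨hl2, hlow, hh1M, hc⟩
      · rw [if_neg hh1'] at hpos
        have : 0 < f l₂ h := by have := ind_nn (h = h₂); nlinarith
        exact hsupp l₂ h this
    · rw [val_other l h hl2'] at hpos
      exact hsupp l h hpos
  · -- rows are unchanged
    intro l hlj hllow
    dsimp only
    have hh2M : h₂ ≤ M ∨ ε = 0 := by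
      rcases hε0.lt_or_eq with hpos | h0
      · exact Or.inl (hsupp l₂ h₂ (lt_of_lt_of_le hpos hε)).2.2.1
      · exact Or.inr h0.symm
    rcases hh2M with hh2M | h0
    · have hr1 := BlobDec2.sum_range_const_indicator M h₁ hh1M (ε * (if l = l₂ then (1:ℝ) else 0))
      have hr2 := BlobDec2.sum_range_const_indicator M h₂ hh2M (ε * (if l = l₂ then (1:ℝ) else 0))
      simp only [Finset.sum_add_distrib, Finset.sum_sub_distrib]
      rw [hr1, hr2, hrow l hlj hllow]
      ring
    · simp only [h0, zero_mul, add_zero, sub_zero]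
      exact hrow l hlj hllow
  · -- columns: h₁ within its slack, h₂ does not increase, others unchanged
    intro h hhM hself
    dsimp only
    have hl2r : l₂ ∈ Finset.range (j' + 1) := Finset.mem_range.2 (by omega)
    have e : ∀ l, usage x T j' l h * (f l h
          + ε * (if l = l₂ then (1:ℝ) else 0) * (if h = h₁ then (1:ℝ) else 0)
          - ε * (if l = l₂ then (1:ℝ) else 0) * (if h = h₂ then (1:ℝ) else 0))
        = usage x T j' l h * f l h
          + ((ε * (if h = h₁ then (1:ℝ) else 0) * usage x T j' l h) * (if l = l₂ then (1:ℝ) else 0)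
          - (ε * (if h = h₂ then (1:ℝ) else 0) * usage x T j' l h) * (if l = l₂ then (1:ℝ) else 0)) := fun l => by ring
    have hs1 : ∑ l ∈ Finset.range (j' + 1), (ε * (if h = h₁ then (1:ℝ) else 0) * usage x T j' l h) * (if l = l₂ then (1:ℝ) else 0)
        = ε * (if h = h₁ then (1:ℝ) else 0) * usage x T j' l₂ h :=
      sum_mul_indicator_eq _ (fun l => ε * (if h = h₁ then (1:ℝ) else 0) * usage x T j' l h) l₂ hl2r
    have hs2 : ∑ l ∈ Finset.range (j' + 1), (ε * (if h = h₂ then (1:ℝ) else 0) * usage x T j' l h) * (if l = l₂ then (1:ℝ) else 0)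
        = ε * (if h = h₂ then (1:ℝ) else 0) * usage x T j' l₂ h :=
      sum_mul_indicator_eq _ (fun l => ε * (if h = h₂ then (1:ℝ) else 0) * usage x T j' l h) l₂ hl2r
    simp only [e, Finset.sum_add_distrib, Finset.sum_sub_distrib]
    rw [hs1, hs2]
    have hold := hcol h hhM hself
    by_cases hh1' : h = h₁
    · subst hh1'
      rw [if_pos rfl, if_neg hne]
      simp only [mul_one, mul_zero, zero_mul, sub_zero]
      linarith
    · rw [if_neg hh1']
      by_cases hh2' : h = h₂
      · subst hh2'
        rw [if_pos rfl]
        simp only [mul_one, mul_zero, zero_mul]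
        linarith
      · rw [if_neg hh2']
        simp only [mul_zero, zero_mul, add_zero, sub_zero]
        exact hold


end LawDec

end Quant

end Summit.CriticalPhenomena.PercolationContinuityZ3.Theorems
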